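import Mathlib
import HarnessLib
import Literature.Geometry.DiscreteGeometry.LayerStackings
import Literature.Geometry.DiscreteGeometry.LayerShellPatterns
import Literature.MathematicalPhysics.StatisticalMechanics.BarlowStacking

/-!
# Local layer-propagation lemmas for the finite-ball form of Hales, *Dense Sphere Packings* §1.3 (II)

Route `PricedLinkCensus`, crux `SoftLayerPropagation` (stmt-AtomisticToContinuum-14233), line
`Sketch`, second helper file for the stub `stub_ballPropagation` (frame `u₁ = triangularVec₁ 2`,
`u₂ = triangularVec₂ 2`, `w = barlowOffset 2`, `𝗁 e₃ = layerNormal layerSpacing` of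
`LayerShells.lean`; companion of `…StubBallPropagationLayers.lean`, independent of it).

The one NEW local step a finite-ball version of `HalesDSP_layerPackings_holds` needs beyond the
tree's (localised) FCC/HCP propagation steps: ONE LAYER FORCES THE NEXT, SITE BY SITE.  In the tree
(`exists_next_layer`) the hexagon of a centre of the next layer comes for free from the fullness of
the whole layer below; on a ball it must be produced from finitely many occupied positions, and the
pattern hypothesis at the new site is what makes this possible:

* `fccTab_sub_of_adj`, `hcpTab_triangle` (`decide` on the integer tables of `KissingRigidity.lean`)
  and their transfers `sub_mem_kissingShell_of_fcc`, `sub_mem_kissingShell_of_hcp_triangle`,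
  `sub_mem_kissingShell_of_triangle`: in an FCC shell the difference of two touching shell points
  is a shell point; in an HCP shell of a PACKING, for a triangle `a, b, c` of touching shell points
  `a − c` is a shell point as soon as the far corner `y + (a + b − c)` is a centre (the only
  obstruction, a lateral triangle of the anticuboctahedron — a twin plane tilted against the
  layer — would put a shell point at distance `2/√3 < 2` from that corner);
* `hexagon_subset_kissingShell_of_hole` — hence the pattern shell of a site `p + d` over the hole
  of an occupied triangle `p, p + η, p + η′` contains the whole hexagon `{±η, ±η′, ±(η − η′)}` once
  `p ± (η − η′)` and the far corner `p + (η + η′)` are occupied;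
* `hexagonSet_subset_kissingShell_of_holeTriple` — the same in the frame: `p` with occupied
  hexagon, `t ∈ holeTriple σ`, side `s = ±1`, far corner `p + 3t`, new site `p + t + s 𝗁 e₃`.

All statements are elementary ([folklore]).
-/

noncomputable section

namespace Summit.AtomisticToContinuum.Crystallization.Theorems

open Literature.Geometry.DiscreteGeometry Literature.MathematicalPhysics.StatisticalMechanics
open RealInnerProductSpace

/-! ### Differences of touching shell points (the two patterns, by their integer tables) -/

/-- **FCC table: the difference of two adjacent cuboctahedron vertices is a vertex** (the minimal
vectors of `D₃` at `60°` differ by a minimal vector). [folklore] -/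
theorem fccTab_sub_of_adj : ∀ i j : Fin 12, fccAdj i j → ∃ m : Fin 12, fccTab m = fccTab i - fccTab j := by
  decide

/-- **HCP table: differences inside a triangle.**  For a triangle `i, j, k` of the
anticuboctahedron graph, either `tᵢ − tₖ` is a vertex, or (the triangle is lateral with `tₖ`
equatorial and `tᵢ` polar on the wrong side) some vertex `tₘ` is at squared distance `6 < 18` from
the far corner `tᵢ + tⱼ − tₖ`. [folklore] -/
theorem hcpTab_triangle : ∀ i j k : Fin 12, hcpAdj i j → hcpAdj j k → hcpAdj i k →
    (∃ m : Fin 12, hcpTab m = hcpTab i - hcpTab k) ∨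
      (∃ m : Fin 12, sqNormInt (hcpTab m - (hcpTab i + hcpTab j - hcpTab k)) = 6) := by
  decide

/-- The norm of a reference point: `‖2t/√N‖ = 2 √|t|² / √N`. [folklore] -/
theorem norm_refPt_eq (N : ℕ) (t : Fin 3 → ℤ) :
    ‖refPt N t‖ = 2 * ((Real.sqrt N)⁻¹ * Real.sqrt (sqNormInt t : ℝ)) := by
  rw [refPt, norm_smul, norm_smul, norm_inv, Real.norm_of_nonneg (Real.sqrt_nonneg _), norm_intVec,
    Real.norm_of_nonneg zero_le_two]

/-- **In an FCC shell, the difference of two touching shell points is a shell point** (transfer of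
`fccTab_sub_of_adj` along the isometry of `IsArrangedIn`). [folklore] -/
theorem sub_mem_kissingShell_of_fcc {V : Set (EuclideanSpace ℝ (Fin 3))}
    {y a b : EuclideanSpace ℝ (Fin 3)} (hfcc : IsArrangedIn (kissingShell V y) fccKissingPattern)
    (ha : a ∈ kissingShell V y) (hb : b ∈ kissingShell V y) (hab : dist a b = 2) :
    a - b ∈ kissingShell V y := by
  obtain ⟨A, hA⟩ := isArrangedIn_fcc_iff_range.1 hfcc
  rw [hA] at ha hb ⊢
  obtain ⟨i, rfl⟩ := ha
  obtain ⟨j, rfl⟩ := hb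
  have hij : fccAdj i j := by
    simp only [fccRef, dist_map_refPt_eq_two_iff two_ne_zero] at hab
    exact_mod_cast hab
  obtain ⟨m, hm⟩ := fccTab_sub_of_adj i j hij
  exact ⟨m, by simp only [fccRef, hm, refPt_sub, map_sub]⟩

/-- **In an HCP shell of a packing, differences inside a triangle with occupied far corner are
shell points.**  If `a, b, c` are pairwise touching points of the HCP-arranged shell of `y` and the
far corner `y + (a + b − c)` is a centre of the packing, then `a − c` is a shell point: otherwise
(`hcpTab_triangle`) a shell point would be a centre at distance `2√6/√18 = 2/√3 < 2` from that
corner. [folklore] -/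
theorem sub_mem_kissingShell_of_hcp_triangle {V : Set (EuclideanSpace ℝ (Fin 3))}
    (hV : IsUnitBallPacking V) {y a b c : EuclideanSpace ℝ (Fin 3)}
    (hhcp : IsArrangedIn (kissingShell V y) hcpKissingPattern)
    (ha : a ∈ kissingShell V y) (hb : b ∈ kissingShell V y) (hc : c ∈ kissingShell V y)
    (hab : dist a b = 2) (hbc : dist b c = 2) (hac : dist a c = 2)
    (hout : y + (a + b - c) ∈ V) : a - c ∈ kissingShell V y := by
  obtain ⟨A, hA⟩ := isArrangedIn_hcp_iff_range.1 hhcp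
  have ha' := ha
  have hb' := hb
  have hc' := hc
  rw [hA] at ha' hb' hc'
  obtain ⟨i, rfl⟩ := ha'
  obtain ⟨j, rfl⟩ := hb'
  obtain ⟨k, rfl⟩ := hc'
  have h18 : (18 : ℕ) ≠ 0 := by norm_num
  have hij : hcpAdj i j := by
    simp only [hcpRef, dist_map_refPt_eq_two_iff h18] at hab
    exact_mod_cast hab
  have hjk : hcpAdj j k := by
    simp only [hcpRef, dist_map_refPt_eq_two_iff h18] at hbc
    exact_mod_cast hbc
  have hik : hcpAdj i k := by
    simp only [hcpRef, dist_map_refPt_eq_two_iff h18] at hac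
    exact_mod_cast hac
  rcases hcpTab_triangle i j k hij hjk hik with ⟨m, hm⟩ | ⟨m, hm⟩
  · rw [hA]; exact ⟨m, by simp only [hcpRef, hm, refPt_sub, map_sub]⟩
  · exfalso
    have hmV : y + A (hcpRef m) ∈ V := by
      have : A (hcpRef m) ∈ kissingShell V y := by rw [hA]; exact ⟨m, rfl⟩
      exact this.1
    have hdiff : A (hcpRef m) - (A (hcpRef i) + A (hcpRef j) - A (hcpRef k)) =
        A (refPt 18 (hcpTab m - (hcpTab i + hcpTab j - hcpTab k))) := by
      simp only [hcpRef, refPt_sub, refPt_add, map_sub, map_add]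
    have h6 : ((6 : ℤ) : ℝ) = 6 := by norm_num
    have hnorm : ‖A (hcpRef m) - (A (hcpRef i) + A (hcpRef j) - A (hcpRef k))‖ =
        2 * ((Real.sqrt ((18 : ℕ) : ℝ))⁻¹ * Real.sqrt 6) := by
      rw [hdiff, A.norm_map, norm_refPt_eq, hm, h6]
    have hpos : (0 : ℝ) < Real.sqrt ((18 : ℕ) : ℝ) := by positivity
    have hratio : (Real.sqrt ((18 : ℕ) : ℝ))⁻¹ * Real.sqrt 6 < 1 := by
      rw [inv_mul_lt_iff₀ hpos, mul_one]
      exact Real.sqrt_lt_sqrt (by norm_num) (by norm_num)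
    have hlt : dist (y + A (hcpRef m)) (y + (A (hcpRef i) + A (hcpRef j) - A (hcpRef k))) < 2 := by
      rw [dist_add_left, dist_eq_norm, hnorm]
      linarith
    have heq := hV hmV hout hlt
    have h0 : A (refPt 18 (hcpTab m - (hcpTab i + hcpTab j - hcpTab k))) = 0 := by
      rw [← hdiff, sub_eq_zero]; exact add_left_cancel heq
    have hn0 : ‖A (refPt 18 (hcpTab m - (hcpTab i + hcpTab j - hcpTab k)))‖ = 0 := by
      rw [h0, norm_zero]
    rw [A.norm_map, norm_refPt_eq, hm, h6] at hn0
    have h6pos : (0 : ℝ) < Real.sqrt 6 := by positivity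
    have : (0 : ℝ) < 2 * ((Real.sqrt ((18 : ℕ) : ℝ))⁻¹ * Real.sqrt 6) := by positivity
    linarith

/-- **Differences inside a triangle of a pattern shell** (FCC or HCP) with occupied far corner are
shell points (`sub_mem_kissingShell_of_fcc`, `sub_mem_kissingShell_of_hcp_triangle`). [folklore] -/
theorem sub_mem_kissingShell_of_triangle {V : Set (EuclideanSpace ℝ (Fin 3))}
    (hV : IsUnitBallPacking V) {y a b c : EuclideanSpace ℝ (Fin 3)}
    (hpat : IsArrangedIn (kissingShell V y) fccKissingPattern ∨
      IsArrangedIn (kissingShell V y) hcpKissingPattern)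
    (ha : a ∈ kissingShell V y) (hb : b ∈ kissingShell V y) (hc : c ∈ kissingShell V y)
    (hab : dist a b = 2) (hbc : dist b c = 2) (hac : dist a c = 2)
    (hout : y + (a + b - c) ∈ V) : a - c ∈ kissingShell V y := by
  rcases hpat with h | h
  · exact sub_mem_kissingShell_of_fcc h ha hc hac
  · exact sub_mem_kissingShell_of_hcp_triangle hV h ha hb hc hab hbc hac hout

/-! ### The shell of a pattern site over an occupied hole -/

/-- **A pattern shell over an occupied hole with occupied rim contains the hexagon.**  Let
`(η, η′)` be a hexagonal pair (norms `2`, inner product `2`) and `d` a vector of norm `2` with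
`⟪d, η⟫ = ⟪d, η′⟫ = 2` (so `p + d` sits over the hole of the triangle `p, p + η, p + η′`, above or
below).  If `p, p + η, p + η′, p ± (η − η′)` and the far corner `p + (η + η′)` are centres of the
packing and the shell of `p + d` is a pattern, then that shell contains the whole hexagon
`{±η, ±η′, ±(η − η′)}`: its three points `−d, η − d, η′ − d` form a triangle whose three far
corners are occupied, so all their differences are shell points
(`sub_mem_kissingShell_of_triangle`). [folklore] -/
theorem hexagon_subset_kissingShell_of_hole {V : Set (EuclideanSpace ℝ (Fin 3))}
    (hV : IsUnitBallPacking V) {η η' d p : EuclideanSpace ℝ (Fin 3)}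
    (hη : ⟪η, η⟫ = 4) (hη' : ⟪η', η'⟫ = 4) (hηη' : ⟪η, η'⟫ = 2)
    (hd : ⟪d, d⟫ = 4) (hdη : ⟪d, η⟫ = 2) (hdη' : ⟪d, η'⟫ = 2)
    (hp : p ∈ V) (h₁ : p + η ∈ V) (h₂ : p + η' ∈ V) (h₃ : p + (η - η') ∈ V)
    (h₄ : p + (η' - η) ∈ V) (h₅ : p + (η + η') ∈ V)
    (hpat : IsArrangedIn (kissingShell V (p + d)) fccKissingPattern ∨
      IsArrangedIn (kissingShell V (p + d)) hcpKissingPattern) :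
    ({η, -η, η', -η', η - η', η' - η} : Set (EuclideanSpace ℝ (Fin 3))) ⊆
      kissingShell V (p + d) := by
  have hη'η : ⟪η', η⟫ = 2 := by rw [real_inner_comm, hηη']
  have hηd : ⟪η, d⟫ = 2 := by rw [real_inner_comm, hdη]
  have hη'd : ⟪η', d⟫ = 2 := by rw [real_inner_comm, hdη']
  set y := p + d with hy
  -- the triangle below/above `y`
  have m₁ : -d ∈ kissingShell V y :=
    mem_kissingShell_of_inner (by rw [hy, add_neg_cancel_right]; exact hp)
      (by simp only [inner_neg_left, inner_neg_right, hd, neg_neg])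
  have m₂ : η - d ∈ kissingShell V y :=
    mem_kissingShell_of_inner
      (by have : y + (η - d) = p + η := by rw [hy]; abel
          rw [this]; exact h₁)
      (by simp only [inner_sub_left, inner_sub_right, hη, hd, hdη, hηd]; norm_num)
  have m₃ : η' - d ∈ kissingShell V y :=
    mem_kissingShell_of_inner
      (by have : y + (η' - d) = p + η' := by rw [hy]; abel
          rw [this]; exact h₂)
      (by simp only [inner_sub_left, inner_sub_right, hη', hd, hdη', hη'd]; norm_num)
  have d₁₂ : dist (-d) (η - d) = 2 := dist_eq_two_iff_inner.2 (by
    have : -d - (η - d) = -η := by abel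
    rw [this]; simp only [inner_neg_left, inner_neg_right, hη, neg_neg])
  have d₂₁ : dist (η - d) (-d) = 2 := by rw [dist_comm, d₁₂]
  have d₁₃ : dist (-d) (η' - d) = 2 := dist_eq_two_iff_inner.2 (by
    have : -d - (η' - d) = -η' := by abel
    rw [this]; simp only [inner_neg_left, inner_neg_right, hη', neg_neg])
  have d₃₁ : dist (η' - d) (-d) = 2 := by rw [dist_comm, d₁₃]
  have d₂₃ : dist (η - d) (η' - d) = 2 := dist_eq_two_iff_inner.2 (by
    have : η - d - (η' - d) = η - η' := by abel
    rw [this]; simp only [inner_sub_left, inner_sub_right, hη, hη', hηη', hη'η]; norm_num)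
  have d₃₂ : dist (η' - d) (η - d) = 2 := by rw [dist_comm, d₂₃]
  -- the three far corners
  have o₁ : y + (η - d + (η' - d) - -d) ∈ V := by
    have : y + (η - d + (η' - d) - -d) = p + (η + η') := by rw [hy]; abel
    rw [this]; exact h₅
  have o₁' : y + (η' - d + (η - d) - -d) ∈ V := by
    have : y + (η' - d + (η - d) - -d) = p + (η + η') := by rw [hy]; abel
    rw [this]; exact h₅
  have o₂ : y + (-d + (η' - d) - (η - d)) ∈ V := by
    have : y + (-d + (η' - d) - (η - d)) = p + (η' - η) := by rw [hy]; abel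
    rw [this]; exact h₄
  have o₂' : y + (η' - d + -d - (η - d)) ∈ V := by
    have : y + (η' - d + -d - (η - d)) = p + (η' - η) := by rw [hy]; abel
    rw [this]; exact h₄
  have o₃ : y + (-d + (η - d) - (η' - d)) ∈ V := by
    have : y + (-d + (η - d) - (η' - d)) = p + (η - η') := by rw [hy]; abel
    rw [this]; exact h₃
  have o₃' : y + (η - d + -d - (η' - d)) ∈ V := by
    have : y + (η - d + -d - (η' - d)) = p + (η - η') := by rw [hy]; abel
    rw [this]; exact h₃
  -- the six differences
  have e₁ : η = η - d - -d := by abel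
  have e₂ : -η = -d - (η - d) := by abel
  have e₃ : η' = η' - d - -d := by abel
  have e₄ : -η' = -d - (η' - d) := by abel
  have e₅ : η - η' = η - d - (η' - d) := by abel
  have e₆ : η' - η = η' - d - (η - d) := by abel
  have k₁ : η ∈ kissingShell V y :=
    e₁ ▸ sub_mem_kissingShell_of_triangle hV hpat m₂ m₃ m₁ d₂₃ d₃₁ d₂₁ o₁
  have k₂ : -η ∈ kissingShell V y :=
    e₂ ▸ sub_mem_kissingShell_of_triangle hV hpat m₁ m₃ m₂ d₁₃ d₃₂ d₁₂ o₂
  have k₃ : η' ∈ kissingShell V y :=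
    e₃ ▸ sub_mem_kissingShell_of_triangle hV hpat m₃ m₂ m₁ d₃₂ d₂₁ d₃₁ o₁'
  have k₄ : -η' ∈ kissingShell V y :=
    e₄ ▸ sub_mem_kissingShell_of_triangle hV hpat m₁ m₂ m₃ d₁₂ d₂₃ d₁₃ o₃
  have k₅ : η - η' ∈ kissingShell V y :=
    e₅ ▸ sub_mem_kissingShell_of_triangle hV hpat m₂ m₁ m₃ d₂₁ d₁₃ d₂₃ o₃'
  have k₆ : η' - η ∈ kissingShell V y :=
    e₆ ▸ sub_mem_kissingShell_of_triangle hV hpat m₃ m₁ m₂ d₃₁ d₁₂ d₃₂ o₂'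
  intro x hx
  simp only [Set.mem_insert_iff, Set.mem_singleton_iff] at hx
  rcases hx with rfl | rfl | rfl | rfl | rfl | rfl <;> assumption

/-! ### In the frame: the site over a hole of a centre whose hexagon is occupied -/

/-- **The site over a hole, in the frame.**  Let `p` be a centre whose six hexagon neighbours
`p + hexagonSet` are centres, `t ∈ holeTriple σ` a hole point (`σ = ±1`), `s = ±1` a side, and
suppose the far corner `p + 3t` is a centre and the shell of `y = p + t + s 𝗁 e₃` is a pattern.
Then the shell of `y` contains the standard hexagon (`hexagon_subset_kissingShell_of_hole` for the
hexagonal pair spanning the triangle of the hole `t`, whose corners are `p, p + η, p + η′` with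
`η + η′ = 3t`). [folklore] -/
theorem hexagonSet_subset_kissingShell_of_holeTriple {V : Set (EuclideanSpace ℝ (Fin 3))}
    (hV : IsUnitBallPacking V) {σ s : ℝ} (hσ : σ = 1 ∨ σ = -1) (hs : s = 1 ∨ s = -1)
    {p t : EuclideanSpace ℝ (Fin 3)} (hp : p ∈ V) (hH : ∀ x ∈ hexagonSet, p + x ∈ V)
    (ht : t ∈ holeTriple σ) (hfar : p + (3 : ℝ) • t ∈ V)
    (hpat : IsArrangedIn (kissingShell V (p + (t + s • layerNormal layerSpacing))) fccKissingPattern ∨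
      IsArrangedIn (kissingShell V (p + (t + s • layerNormal layerSpacing))) hcpKissingPattern) :
    hexagonSet ⊆ kissingShell V (p + (t + s • layerNormal layerSpacing)) := by
  have hs2 : s * s = 1 := by rcases hs with rfl | rfl <;> norm_num
  -- the generic step, for the hexagonal pair `(η, η')` of the hole `t`
  have key : ∀ η η' : EuclideanSpace ℝ (Fin 3),
      hexagonSet = ({η, -η, η', -η', η - η', η' - η} : Set (EuclideanSpace ℝ (Fin 3))) →
      ⟪η, η⟫ = 4 → ⟪η', η'⟫ = 4 → ⟪η, η'⟫ = 2 → ⟪t, η⟫ = 2 → ⟪t, η'⟫ = 2 → ⟪t, t⟫ = 4 / 3 →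
      ⟪t, layerNormal layerSpacing⟫ = 0 → η + η' = (3 : ℝ) • t →
      hexagonSet ⊆ kissingShell V (p + (t + s • layerNormal layerSpacing)) := by
    intro η η' hhex hη hη' hηη' htη htη' htt hte hsum
    have h₁ : p + η ∈ V := hH η (by rw [hhex]; simp)
    have h₂ : p + η' ∈ V := hH η' (by rw [hhex]; simp)
    have h₃ : p + (η - η') ∈ V := hH _ (by rw [hhex]; simp)
    have h₄ : p + (η' - η) ∈ V := hH _ (by rw [hhex]; simp)
    have h₅ : p + (η + η') ∈ V := by rw [hsum]; exact hfar
    have het : ⟪layerNormal layerSpacing, t⟫ = 0 := by rw [real_inner_comm, hte]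
    have hee : ⟪(layerNormal layerSpacing : EuclideanSpace ℝ (Fin 3)), layerNormal layerSpacing⟫ =
        8 / 3 := inner_frameE_frameE
    have heη : ⟪layerNormal layerSpacing, η⟫ = 0 := by
      rw [inner_fin3, apply_two_of_mem_hexagonSet (show η ∈ hexagonSet by rw [hhex]; simp)]; simp
    have heη' : ⟪layerNormal layerSpacing, η'⟫ = 0 := by
      rw [inner_fin3, apply_two_of_mem_hexagonSet (show η' ∈ hexagonSet by rw [hhex]; simp)]; simp
    have hd : ⟪t + s • layerNormal layerSpacing, t + s • layerNormal layerSpacing⟫ = 4 := by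
      simp only [inner_add_left, inner_add_right, inner_smul_left, inner_smul_right, htt, hte, het,
        hee, RCLike.conj_to_real]
      linear_combination (8 / 3 : ℝ) * hs2
    have hdη : ⟪t + s • layerNormal layerSpacing, η⟫ = 2 := by
      simp only [inner_add_left, inner_smul_left, htη, heη, RCLike.conj_to_real]; ring
    have hdη' : ⟪t + s • layerNormal layerSpacing, η'⟫ = 2 := by
      simp only [inner_add_left, inner_smul_left, htη', heη', RCLike.conj_to_real]; ring
    rw [hhex]
    exact hexagon_subset_kissingShell_of_hole hV hη hη' hηη' hd hdη hdη' hp h₁ h₂ h₃ h₄ h₅ hpat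
  -- the six holes
  rw [mem_holeTriple_iff] at ht
  obtain ⟨t₁, ht₁, rfl⟩ := ht
  rw [mem_holeTriple_one_iff] at ht₁
  have hwe : ⟪(barlowOffset 2 : EuclideanSpace ℝ (Fin 3)), layerNormal layerSpacing⟫ = 0 :=
    inner_frameW_frameE
  rcases hσ with rfl | rfl <;> rcases ht₁ with rfl | rfl | rfl
  · -- `t = w`: pair `(u₁, u₂)`
    refine key _ _ hexagonSet_eq_uv inner_frameU_frameU inner_frameV_frameV inner_frameU_frameV
      ?_ ?_ ?_ ?_ ?_
    · simp only [one_smul, inner_frameW_frameU]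
    · simp only [one_smul, inner_frameW_frameV]
    · simp only [one_smul, inner_frameW_frameW]
    · simp only [one_smul, inner_frameW_frameE]
    · rw [one_smul, three_smul_barlowOffset]
  · -- `t = w − u₁`: pair `(−u₁, u₂ − u₁)`
    refine key _ _ hexagonSet_eq_nu_vmu ?_ inner_self_frameV_sub_frameU ?_ ?_ ?_ ?_ ?_ ?_
    · simp only [inner_neg_left, inner_neg_right, inner_frameU_frameU, neg_neg]
    · simp only [inner_neg_left, inner_sub_right, inner_frameU_frameV, inner_frameU_frameU]; norm_num
    · simp only [one_smul, inner_sub_left, inner_neg_right, inner_frameW_frameU, inner_frameU_frameU]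
      norm_num
    · simp only [one_smul, inner_sub_left, inner_sub_right, inner_frameW_frameV, inner_frameW_frameU,
        inner_frameU_frameV, inner_frameU_frameU]; norm_num
    · simp only [one_smul, inner_sub_left, inner_sub_right, inner_frameW_frameW, inner_frameW_frameU,
        inner_frameU_frameW, inner_frameU_frameU]; norm_num
    · simp only [one_smul, inner_sub_left, inner_frameW_frameE, inner_frameU_frameE]; norm_num
    · rw [one_smul, smul_sub, three_smul_barlowOffset]; module
  · -- `t = w − u₂`: pair `(−u₂, u₁ − u₂)`
    refine key _ _ hexagonSet_eq_nv_umv ?_ inner_self_frameU_sub_frameV ?_ ?_ ?_ ?_ ?_ ?_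
    · simp only [inner_neg_left, inner_neg_right, inner_frameV_frameV, neg_neg]
    · simp only [inner_neg_left, inner_sub_right, inner_frameV_frameU, inner_frameV_frameV]; norm_num
    · simp only [one_smul, inner_sub_left, inner_neg_right, inner_frameW_frameV, inner_frameV_frameV]
      norm_num
    · simp only [one_smul, inner_sub_left, inner_sub_right, inner_frameW_frameU, inner_frameW_frameV,
        inner_frameV_frameU, inner_frameV_frameV]; norm_num
    · simp only [one_smul, inner_sub_left, inner_sub_right, inner_frameW_frameW, inner_frameW_frameV,
        inner_frameV_frameW, inner_frameV_frameV]; norm_num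
    · simp only [one_smul, inner_sub_left, inner_frameW_frameE, inner_frameV_frameE]; norm_num
    · rw [one_smul, smul_sub, three_smul_barlowOffset]; module
  · -- `t = −w`: pair `(−u₁, −u₂)`
    refine key _ _ hexagonSet_eq_nu_nv ?_ ?_ ?_ ?_ ?_ ?_ ?_ ?_
    · simp only [inner_neg_left, inner_neg_right, inner_frameU_frameU, neg_neg]
    · simp only [inner_neg_left, inner_neg_right, inner_frameV_frameV, neg_neg]
    · simp only [inner_neg_left, inner_neg_right, inner_frameU_frameV, neg_neg]
    · simp only [neg_smul, one_smul, inner_neg_left, inner_neg_right, inner_frameW_frameU, neg_neg]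
    · simp only [neg_smul, one_smul, inner_neg_left, inner_neg_right, inner_frameW_frameV, neg_neg]
    · simp only [neg_smul, one_smul, inner_neg_left, inner_neg_right, inner_frameW_frameW, neg_neg]
    · simp only [neg_smul, one_smul, inner_neg_left, inner_frameW_frameE, neg_zero]
    · rw [neg_smul, one_smul, smul_neg, three_smul_barlowOffset]; module
  · -- `t = u₁ − w`: pair `(u₁, u₁ − u₂)`
    refine key _ _ hexagonSet_eq_u_umv inner_frameU_frameU inner_self_frameU_sub_frameV ?_ ?_ ?_ ?_ ?_
      ?_
    · simp only [inner_sub_right, inner_frameU_frameU, inner_frameU_frameV]; norm_num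
    · simp only [neg_smul, one_smul, neg_sub, inner_sub_left, inner_frameU_frameU, inner_frameW_frameU]
      norm_num
    · simp only [neg_smul, one_smul, neg_sub, inner_sub_left, inner_sub_right, inner_frameU_frameU,
        inner_frameU_frameV, inner_frameW_frameU, inner_frameW_frameV]; norm_num
    · simp only [neg_smul, one_smul, neg_sub, inner_sub_left, inner_sub_right, inner_frameU_frameU,
        inner_frameU_frameW, inner_frameW_frameU, inner_frameW_frameW]; norm_num
    · simp only [neg_smul, one_smul, neg_sub, inner_sub_left, inner_frameU_frameE, inner_frameW_frameE]
      norm_num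
    · rw [neg_smul, one_smul, neg_sub, smul_sub, three_smul_barlowOffset]; module
  · -- `t = u₂ − w`: pair `(u₂, u₂ − u₁)`
    refine key _ _ hexagonSet_eq_v_vmu inner_frameV_frameV inner_self_frameV_sub_frameU ?_ ?_ ?_ ?_ ?_
      ?_
    · simp only [inner_sub_right, inner_frameV_frameV, inner_frameV_frameU]; norm_num
    · simp only [neg_smul, one_smul, neg_sub, inner_sub_left, inner_frameV_frameV, inner_frameW_frameV]
      norm_num
    · simp only [neg_smul, one_smul, neg_sub, inner_sub_left, inner_sub_right, inner_frameV_frameV,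
        inner_frameV_frameU, inner_frameW_frameV, inner_frameW_frameU]; norm_num
    · simp only [neg_smul, one_smul, neg_sub, inner_sub_left, inner_sub_right, inner_frameV_frameV,
        inner_frameV_frameW, inner_frameW_frameV, inner_frameW_frameW]; norm_num
    · simp only [neg_smul, one_smul, neg_sub, inner_sub_left, inner_frameV_frameE, inner_frameW_frameE]
      norm_num
    · rw [neg_smul, one_smul, neg_sub, smul_sub, three_smul_barlowOffset]; module

/-- **Registered sub-goal `ballPropagation_hexagonOverHole`** of the crux item (one layer forces
the next, site by site, in closed form): `hexagonSet_subset_kissingShell_of_holeTriple`. [folklore] -/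
theorem ballPropagation_hexagonOverHole :
    ∀ (V : Set (EuclideanSpace ℝ (Fin 3))), Literature.Geometry.DiscreteGeometry.IsUnitBallPacking
    V → ∀ (σ s : ℝ), (σ = 1 ∨ σ = -1) → (s = 1 ∨ s = -1) → ∀ (p t : EuclideanSpace ℝ (Fin 3)), p ∈
    V → (∀ x ∈ Literature.Geometry.DiscreteGeometry.hexagonSet, p + x ∈ V) → t ∈
    Literature.Geometry.DiscreteGeometry.holeTriple σ → p + (3 : ℝ) • t ∈ V →
    (Literature.Geometry.DiscreteGeometry.IsArrangedIn
    (Literature.Geometry.DiscreteGeometry.kissingShell V (p + (t + s •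
    Literature.MathematicalPhysics.StatisticalMechanics.layerNormal
    Literature.Geometry.DiscreteGeometry.layerSpacing)))
    Literature.Geometry.DiscreteGeometry.fccKissingPattern ∨
    Literature.Geometry.DiscreteGeometry.IsArrangedIn
    (Literature.Geometry.DiscreteGeometry.kissingShell V (p + (t + s •
    Literature.MathematicalPhysics.StatisticalMechanics.layerNormal
    Literature.Geometry.DiscreteGeometry.layerSpacing)))
    Literature.Geometry.DiscreteGeometry.hcpKissingPattern) →
    Literature.Geometry.DiscreteGeometry.hexagonSet ⊆
    Literature.Geometry.DiscreteGeometry.kissingShell V (p + (t + s •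
    Literature.MathematicalPhysics.StatisticalMechanics.layerNormal
    Literature.Geometry.DiscreteGeometry.layerSpacing)) :=
  fun _ hV _ _ hσ hs _ _ hp hH ht hfar hpat =>
    hexagonSet_subset_kissingShell_of_holeTriple hV hσ hs hp hH ht hfar hpat

end Summit.AtomisticToContinuum.Crystallization.Theorems

end
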